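/-
Copyright: statement-level skeleton of a published paper (lit-balaban cell, Phase-2 proof seat p39 gen 7). No proof claims
beyond what the kernel checks below.
-/
import Literature.MathematicalPhysics.QuantumFieldTheory.Balaban1983to89.B3Eq323CrossTermsZeroTorus

/-!
# B3 — T. Bałaban, *(Higgs)₂,₃ quantum fields in a finite volume. III. Renormalization*, CMP **88** (1983) 411–445
[Balaban1983Higgs3], pp. 440–441 [PDF 30–31]: MODEL-FREE IDENTITIES AND ESTIMATES FOR THE TWO NONLOCAL GRAPHS OF THE VECTOR
SELF-ENERGY (3.26), `tr q²(X∂^*_{μ′})(x,x′)(Y∂^*_μ)(x′,x)` (r15's `kerA`) and `tr q² X(x,x′)(∂_{μ′}Y∂^*_μ)(x′,x)` (`kerB`), used by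
p. 441's replacement of the propagator (*"If at least one propagator G_{j₀}(0) is replaced by G_{j₀}(0)(1 − m²_{j₀} −
a_{j₀}P_{j₀})C^ξ, then we get a convergent expression"*) for the function `Π_{μμ′}`: the SUMMATION BY PARTS in `x′` printed on
p. 441 as *"We have used … the integration by parts formula"* (moving the column difference `∂^*_{μ′}` from one factor to the
other), the stability of the kernel shapes `(ξ·max(1,|·|))^{−p}e^{−β·}` under a unit shift of one argument, the generic
estimate of a summand `ξ^d·τ·f(x′)g(x′)` with `|f| ≤ c₁(ξ max(1,|x−x′|))^{−p}`, `|g| ≤ c₂(…)^{−q}e^{−δ…}`, `p + q ≤ 2`, and the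
expansion of `Π_{μμ′}[C + M] − Π_{μμ′}[C]` (r15's `Pi2`) into the graphs with at least one `M`

statement-level skeleton of published theorems with citation tags; proofs where landed; nothing here is a claim about
the Yang–Mills mass gap

PDF held: `paper:balaban1983-higgs-2-3-quantum-fields-finite-volume` (journal page = PDF page + 410); pp. 440–441 read on the ×2
renders `run/shared/lean/pub/pub-balaban/b2b-balaban-ref1/pages/1983-cmp88-higgs23-III/1983-cmp88-higgs23-III-p030-x2.png`,
`…-p031-x2.png`.  Row **B3.Eq3.25-3.32** of `HOME/lit-balaban-r15/ROWS-B3.md` (fold owner r15; `Pi2`, `kerA`, `kerB`, `kerC`,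
`dAdjKernel`, `d2Kernel` are r15's `B3Sect3VectorSelfEnergy`).  Everything here is on an arbitrary torus level `T^{(j)}` with an
arbitrary difference-quotient constant `c` (= ξ⁻¹) and weight `w` (= ξ^d); gen 6 inputs `sum_profile_le`, `sum_profile_one_le`,
`sum_exp_le`, `supDist_triangle'`, `B3TorusRadialSums.{supDist_eq_sup_cdist, cdist_*}`, `LatticeFieldCalculus.shiftEquiv`.
* §1 `sum_fwdDiff_mul` (discrete integration by parts), **`sum_kerA_parts`** (`Σ_{x′}w·τ(X∂^*_{μ′})(y,x′)(Y∂^*_μ)(x′,y) =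
  −Σ_{x′}w·τX(y,x′+e_{μ′})(∂_{μ′}Y∂^*_μ)(x′,y)`), **`sum_kerB_parts`** (`Σ_{x′}w·τX(y,x′)(∂_{μ′}Y∂^*_μ)(x′,y) =
  −Σ_{x′}w·τ(X∂^*_{μ′})(y,x′)(Y∂^*_μ)(x′+e_{μ′},y)`).
* §2 `supDist_shift_le_one`, **`profile_shift_le`** (`P_p^β(z′,x) ≤ 2^pe^β·P_p^β(z,x)` when `|z−z′|_∞ ≤ 1`, `0 < ξ ≤ 1`).
* §3 **`sum_term_le₂`** (`|Σ_{x′}ξ^d·τf(x′)g(x′)| ≤ |τ|c₁c₂(1 + radialConst 3 δ 1 i)`, `p + q + i = 2`), `abs_sum_kerC_le`, `sum_kerA_eq_mul`.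
* §4 `kerC_add_add`, **`Pi2_add_sub`** (`Π[C+M, C+M, C+M] − Π[C,C,C]` = the three nonlocal graphs with `[M,M], [M,C], [C,M]` minus
  the two local terms with `M`).
HONEST SCOPE: model-free lattice identities/estimates (`d = 3`, sup torus distance, in §3); no propagator is instantiated here
(that is the sequel `B3Pi2CrossTermsZeroTorus`).  Mathlib + the cited tree files only; theorems only, no definitions, no named
facts; standard axioms.  Unit `lit-balaban-p39-g7` (Phase-2 proof seat p39, gen 7), HOME `run/shared/lean/pub/lit-balaban/`, 2026-08-21.
-/

open scoped BigOperators

namespace Literature.MathematicalPhysics.QuantumFieldTheory.Balaban1983to89.B3Eq326GraphKernelParts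

open Matrix Finset B1RG242Torus B3KernelConvolutionTorus B3KernelConvolutionTorusSup
open LatticeFieldCalculus B3Sect3ScalarSelfEnergy B3TorusRadialSums B3Bound316
open B3Sect3VectorSelfEnergy (dAdjKernel d2Kernel kerA kerB kerC Pi2)

noncomputable section

variable {P : Params} {j : ℕ}

/-! ## §1 Summation by parts in the column variable -/

section Parts

/-- kernel: reindexing a torus sum by the translation `x′ ↦ x′ + e_μ`. [folklore] -/
private theorem sum_shift (μ : Fin P.d) (F : Site P j → ℝ) : ∑ x' : Site P j, F (x'.shift μ) = ∑ x' : Site P j, F x' :=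
  Equiv.sum_comp (shiftEquiv (P := P) (j := j) μ) F

/-- kernel: the discrete integration by parts `Σ_{x′}(φ(x′+e) − φ(x′))ψ(x′) = −Σ_{x′}φ(x′+e)(ψ(x′+e) − ψ(x′))` on the torus.
[cite: Balaban1983Higgs3, (3.27) p.441] -/
theorem sum_fwdDiff_mul (μ : Fin P.d) (φ ψ : Site P j → ℝ) :
    ∑ x' : Site P j, (φ (x'.shift μ) - φ x') * ψ x' = -∑ x' : Site P j, φ (x'.shift μ) * (ψ (x'.shift μ) - ψ x') := by
  have h := sum_shift μ (fun x' => φ x' * ψ x')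
  simp only [sub_mul, mul_sub, Finset.sum_sub_distrib, neg_sub]
  linarith

/-- **Summation by parts for the first graph of (3.26)** (*"the integration by parts formula"*, p. 441): for all kernels `X, Y`,
`Σ_{x′}w·τ(X∂^*_{μ′})(y,x′)(Y∂^*_μ)(x′,y) = −Σ_{x′}w·τ·X(y,x′+e_{μ′})·(∂_{μ′}Y∂^*_μ)(x′,y)` — the column difference `∂^*_{μ′}` moves
from `X` onto `Y∂^*_μ`, producing the mixed second difference (any difference-quotient constant `c`, any weight `w`).
[cite: Balaban1983Higgs3, (3.26) p.440, (3.27) p.441] -/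
theorem sum_kerA_parts (w τ c : ℝ) (X Y : Kernel P j) (μ μ' : Fin P.d) (y : Site P j) :
    ∑ x' : Site P j, w * (τ * (dAdjKernel c μ' X y x' * dAdjKernel c μ Y x' y)) =
      -∑ x' : Site P j, w * (τ * (X y (x'.shift μ') * d2Kernel c μ' μ Y x' y)) := by
  have h := sum_fwdDiff_mul μ' (fun x' => X y x') (fun x' => dAdjKernel c μ Y x' y)
  have hL : ∑ x' : Site P j, w * (τ * (dAdjKernel c μ' X y x' * dAdjKernel c μ Y x' y)) =
      w * τ * c * ∑ x' : Site P j, (X y (x'.shift μ') - X y x') * dAdjKernel c μ Y x' y := by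
    rw [Finset.mul_sum]
    exact Finset.sum_congr rfl fun x' _ => by simp only [dAdjKernel]; ring
  have hR : ∑ x' : Site P j, w * (τ * (X y (x'.shift μ') * d2Kernel c μ' μ Y x' y)) =
      w * τ * c * ∑ x' : Site P j, X y (x'.shift μ') * (dAdjKernel c μ Y (x'.shift μ') y - dAdjKernel c μ Y x' y) := by
    rw [Finset.mul_sum]
    exact Finset.sum_congr rfl fun x' _ => by simp only [dAdjKernel, d2Kernel]; ring
  rw [hL, hR, h, mul_neg]

/-- **Summation by parts for the second graph of (3.26)**: for all kernels `X, Y`,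
`Σ_{x′}w·τ·X(y,x′)(∂_{μ′}Y∂^*_μ)(x′,y) = −Σ_{x′}w·τ(X∂^*_{μ′})(y,x′)(Y∂^*_μ)(x′+e_{μ′},y)` — the row difference `∂_{μ′}` of the mixed
kernel moves onto `X` as a column difference. [cite: Balaban1983Higgs3, (3.26) p.440, (3.27) p.441] -/
theorem sum_kerB_parts (w τ c : ℝ) (X Y : Kernel P j) (μ μ' : Fin P.d) (y : Site P j) :
    ∑ x' : Site P j, w * (τ * (X y x' * d2Kernel c μ' μ Y x' y)) =
      -∑ x' : Site P j, w * (τ * (dAdjKernel c μ' X y x' * dAdjKernel c μ Y (x'.shift μ') y)) := by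
  have h := sum_fwdDiff_mul μ' (fun x' => dAdjKernel c μ Y x' y) (fun x' => X y x')
  have hsw : ∑ x' : Site P j, dAdjKernel c μ Y (x'.shift μ') y * (X y (x'.shift μ') - X y x') =
      ∑ x' : Site P j, (X y (x'.shift μ') - X y x') * dAdjKernel c μ Y (x'.shift μ') y :=
    Finset.sum_congr rfl fun x' _ => mul_comm _ _
  have hL : ∑ x' : Site P j, w * (τ * (X y x' * d2Kernel c μ' μ Y x' y)) =
      w * τ * c * ∑ x' : Site P j, (dAdjKernel c μ Y (x'.shift μ') y - dAdjKernel c μ Y x' y) * X y x' := by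
    rw [Finset.mul_sum]
    exact Finset.sum_congr rfl fun x' _ => by simp only [dAdjKernel, d2Kernel]; ring
  have hR : ∑ x' : Site P j, w * (τ * (dAdjKernel c μ' X y x' * dAdjKernel c μ Y (x'.shift μ') y)) =
      w * τ * c * ∑ x' : Site P j, (X y (x'.shift μ') - X y x') * dAdjKernel c μ Y (x'.shift μ') y := by
    rw [Finset.mul_sum]
    exact Finset.sum_congr rfl fun x' _ => by simp only [dAdjKernel]; ring
  rw [hL, hR, h, hsw, mul_neg]

end Parts

/-! ## §2 A unit shift of one argument changes a kernel profile by a bounded factor -/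

section Shift

/-- `|x − (x + e_μ)|_∞ ≤ 1`. [cite: Balaban1982Higgs1, (1.3) p.604] -/
theorem supDist_shift_le_one (x : Site P j) (μ : Fin P.d) : supDist x (x.shift μ) ≤ 1 := by
  rw [supDist_eq_sup_cdist]
  refine Finset.sup_le fun ν _ => ?_
  by_cases hν : ν = μ
  · subst hν
    have h : x ν - x.shift ν ν = -1 := by simp [Site.shift]
    rw [h, cdist_neg]
    exact (cdist_le_val _).trans (by rw [ZMod.val_one_eq_one_mod]; exact Nat.mod_le 1 _)
  · have h : x.shift μ ν = x ν := by simp [Site.shift, Function.update_of_ne hν]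
    rw [h, sub_self, (cdist_eq_zero_iff _).mpr rfl]
    exact zero_le_one

/-- **Stability of the kernel shapes under a unit shift**: if `|z − z′|_∞ ≤ 1` (`0 < ξ ≤ 1`, `β ≥ 0`), then
`(ξ·max(1,|z′−x|))^{−p}e^{−βξ|z′−x|} ≤ 2^pe^β·(ξ·max(1,|z−x|))^{−p}e^{−βξ|z−x|}` (`max(1,|z−x|) ≤ 2max(1,|z′−x|)`, `|z−x| ≤ |z′−x| + 1`).
[cite: Balaban1983Higgs3, (3.16) p.437] -/
theorem profile_shift_le {ξ β : ℝ} (hξ : 0 < ξ) (hξ1 : ξ ≤ 1) (hβ : 0 ≤ β) (p : ℕ) {z z' : Site P j} (hzz' : supDist z z' ≤ 1)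
    (x : Site P j) :
    ((ξ * max (1 : ℝ) (supDist z' x : ℝ)) ^ p)⁻¹ * Real.exp (-(β * (ξ * (supDist z' x : ℝ)))) ≤
      2 ^ p * Real.exp β * (((ξ * max (1 : ℝ) (supDist z x : ℝ)) ^ p)⁻¹ * Real.exp (-(β * (ξ * (supDist z x : ℝ))))) := by
  have h1 : (supDist z x : ℝ) ≤ 1 + (supDist z' x : ℝ) := by
    have := supDist_triangle' z z' x
    have h' : (supDist z x : ℝ) ≤ (supDist z z' : ℝ) + (supDist z' x : ℝ) := by exact_mod_cast this
    have h'' : (supDist z z' : ℝ) ≤ 1 := by exact_mod_cast hzz'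
    linarith
  have h2 : (supDist z' x : ℝ) ≤ 1 + (supDist z x : ℝ) := by
    have := supDist_triangle' z' z x
    have h' : (supDist z' x : ℝ) ≤ (supDist z' z : ℝ) + (supDist z x : ℝ) := by exact_mod_cast this
    rw [supDist_comm z' z] at h'
    have h'' : (supDist z z' : ℝ) ≤ 1 := by exact_mod_cast hzz'
    linarith
  have hm' : 0 < max (1 : ℝ) (supDist z' x : ℝ) := lt_max_of_lt_left one_pos
  have hm : 0 < max (1 : ℝ) (supDist z x : ℝ) := lt_max_of_lt_left one_pos
  have hmax : max (1 : ℝ) (supDist z x : ℝ) ≤ 2 * max (1 : ℝ) (supDist z' x : ℝ) := by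
    refine max_le (by linarith [le_max_left (1 : ℝ) (supDist z' x : ℝ)]) ?_
    linarith [le_max_left (1 : ℝ) (supDist z' x : ℝ), le_max_right (1 : ℝ) (supDist z' x : ℝ)]
  -- the power factor
  have hpow : ((ξ * max (1 : ℝ) (supDist z' x : ℝ)) ^ p)⁻¹ ≤ 2 ^ p * ((ξ * max (1 : ℝ) (supDist z x : ℝ)) ^ p)⁻¹ := by
    have hle : (ξ * max (1 : ℝ) (supDist z x : ℝ)) ^ p ≤ 2 ^ p * (ξ * max (1 : ℝ) (supDist z' x : ℝ)) ^ p := by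
      rw [← mul_pow]; exact pow_le_pow_left₀ (by positivity) (by nlinarith [hξ.le]) p
    have h0 : 0 < (ξ * max (1 : ℝ) (supDist z x : ℝ)) ^ p := by positivity
    have h0' : 0 < (ξ * max (1 : ℝ) (supDist z' x : ℝ)) ^ p := by positivity
    rw [inv_le_comm₀ h0' (by positivity), mul_inv, inv_inv]
    calc (2 ^ p)⁻¹ * (ξ * max (1 : ℝ) (supDist z x : ℝ)) ^ p ≤ (2 ^ p)⁻¹ * (2 ^ p * (ξ * max (1 : ℝ) (supDist z' x : ℝ)) ^ p) :=
          mul_le_mul_of_nonneg_left hle (by positivity)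
      _ = (ξ * max (1 : ℝ) (supDist z' x : ℝ)) ^ p := by
          rw [← mul_assoc, inv_mul_cancel₀ (by positivity), one_mul]
  -- the exponential factor
  have hexp : Real.exp (-(β * (ξ * (supDist z' x : ℝ)))) ≤ Real.exp β * Real.exp (-(β * (ξ * (supDist z x : ℝ)))) := by
    rw [← Real.exp_add]
    refine Real.exp_le_exp.mpr ?_
    have : β * (ξ * (supDist z x : ℝ)) ≤ β + β * (ξ * (supDist z' x : ℝ)) := by
      have h3 : ξ * (supDist z x : ℝ) ≤ ξ * 1 + ξ * (supDist z' x : ℝ) := by nlinarith [hξ.le]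
      nlinarith [mul_nonneg hβ (mul_nonneg hξ.le (Nat.cast_nonneg (supDist z' x)))]
    linarith
  calc ((ξ * max (1 : ℝ) (supDist z' x : ℝ)) ^ p)⁻¹ * Real.exp (-(β * (ξ * (supDist z' x : ℝ))))
      ≤ (2 ^ p * ((ξ * max (1 : ℝ) (supDist z x : ℝ)) ^ p)⁻¹) * (Real.exp β * Real.exp (-(β * (ξ * (supDist z x : ℝ))))) :=
        mul_le_mul hpow hexp (by positivity) (by positivity)
    _ = _ := by ring

end Shift

/-! ## §3 The generic summand estimate for `Π_{μμ′}` -/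

section Generic

/-- **The generic summand estimate for the nonlocal graphs of `Π_{μμ′}`** (`d = 3`, `0 < ξ ≤ 1`): if `|f(x′)| ≤ c₁(ξ·max(1,|x−x′|))^{−p}`
and `|g(x′)| ≤ c₂(ξ·max(1,|x−x′|))^{−q}e^{−δξ|x−x′|}` with `p + q + i = 2`, `i ≤ 2`, then `|Σ_{x′}ξ^d·τf(x′)g(x′)| ≤ |τ|c₁c₂(1 + radialConst 3 δ 1 i)`.
[cite: Balaban1983Higgs3, (3.16) p.437, (3.26) p.441] -/
theorem sum_term_le₂ (hd : P.d = 3) {ξ : ℝ} (hξ : 0 < ξ) (hξ1 : ξ ≤ 1) {δ : ℝ} (hδ : 0 < δ) {p q i : ℕ} (hpq : p + q + i = 2)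
    (hi : i ≤ 2) {c₁ c₂ : ℝ} (hc₁ : 0 ≤ c₁) (hc₂ : 0 ≤ c₂) (τ : ℝ) (x : Site P j) (f g : Site P j → ℝ)
    (hf : ∀ x' : Site P j, |f x'| ≤ c₁ * ((ξ * max (1 : ℝ) (supDist x x' : ℝ)) ^ p)⁻¹)
    (hg : ∀ x' : Site P j, |g x'| ≤
      c₂ * (((ξ * max (1 : ℝ) (supDist x x' : ℝ)) ^ q)⁻¹ * Real.exp (-(δ * (ξ * (supDist x x' : ℝ)))))) :
    |∑ x' : Site P j, ξ ^ P.d * (τ * (f x' * g x'))| ≤ |τ| * c₁ * c₂ * (1 + radialConst 3 δ 1 i) := by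
  have hw : 0 ≤ ξ ^ P.d := by positivity
  have hpt : ∀ x' : Site P j, |ξ ^ P.d * (τ * (f x' * g x'))| ≤ |τ| * c₁ * c₂ *
      (ξ ^ P.d * (((ξ * max (1 : ℝ) (supDist x x' : ℝ)) ^ (2 - i))⁻¹ * Real.exp (-(δ * (ξ * (supDist x x' : ℝ)))))) := by
    intro x'
    obtain ⟨u, hu⟩ : ∃ u : ℝ, u = ξ * max (1 : ℝ) (supDist x x' : ℝ) := ⟨_, rfl⟩
    have hu0 : 0 < u := by rw [hu]; exact mul_pos hξ (lt_max_of_lt_left one_pos)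
    obtain ⟨e, he⟩ : ∃ e : ℝ, e = Real.exp (-(δ * (ξ * (supDist x x' : ℝ)))) := ⟨_, rfl⟩
    have he0 : 0 < e := by rw [he]; exact Real.exp_pos _
    have hf' := hf x'; have hg' := hg x'
    rw [← hu] at hf' hg'; rw [← he] at hg'
    rw [← hu, ← he, abs_mul, abs_of_nonneg hw, abs_mul, abs_mul]
    have hkey : (u ^ p)⁻¹ * (u ^ q)⁻¹ = (u ^ (2 - i))⁻¹ := by
      have h3 : p + q = 2 - i := by omega
      rw [← mul_inv, ← pow_add, h3]
    calc ξ ^ P.d * (|τ| * (|f x'| * |g x'|))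
        ≤ ξ ^ P.d * (|τ| * (c₁ * (u ^ p)⁻¹ * (c₂ * ((u ^ q)⁻¹ * e)))) := by
          refine mul_le_mul_of_nonneg_left ?_ hw
          exact mul_le_mul_of_nonneg_left (mul_le_mul hf' hg' (abs_nonneg _) (by positivity)) (abs_nonneg τ)
      _ = |τ| * c₁ * c₂ * (ξ ^ P.d * (((u ^ p)⁻¹ * (u ^ q)⁻¹) * e)) := by ring
      _ = |τ| * c₁ * c₂ * (ξ ^ P.d * ((u ^ (2 - i))⁻¹ * e)) := by rw [hkey]
  have hsum : ∑ x' : Site P j, ξ ^ P.d * (((ξ * max (1 : ℝ) (supDist x x' : ℝ)) ^ (2 - i))⁻¹ *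
      Real.exp (-(δ * (ξ * (supDist x x' : ℝ))))) ≤ 1 + radialConst 3 δ 1 i := by
    have hR : radialConst P.d δ ξ i ≤ radialConst 3 δ 1 i := by rw [hd]; exact radialConst_mono 3 hδ hξ1 i
    interval_cases i
    · exact (sum_profile_le hd hξ hξ1 hδ x).trans (by linarith)
    · simp only [show 2 - 1 = 1 from rfl, pow_one]
      exact (sum_profile_one_le hd hξ hξ1 hδ x).trans (by linarith)
    · simp only [Nat.sub_self, pow_zero, inv_one, one_mul]
      exact (sum_exp_le hd hξ hξ1 hδ x).trans (by linarith)
  calc |∑ x' : Site P j, ξ ^ P.d * (τ * (f x' * g x'))|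
      ≤ ∑ x' : Site P j, |ξ ^ P.d * (τ * (f x' * g x'))| := Finset.abs_sum_le_sum_abs _ _
    _ ≤ ∑ x' : Site P j, |τ| * c₁ * c₂ * (ξ ^ P.d * (((ξ * max (1 : ℝ) (supDist x x' : ℝ)) ^ (2 - i))⁻¹ *
          Real.exp (-(δ * (ξ * (supDist x x' : ℝ)))))) := Finset.sum_le_sum fun x' _ => hpt x'
    _ ≤ |τ| * c₁ * c₂ * (1 + radialConst 3 δ 1 i) := by
        rw [← Finset.mul_sum]
        exact mul_le_mul_of_nonneg_left hsum (by positivity)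

/-- kernel: `|Σ_{x′}w·kerC| ≤ |Σ_{x′}w·kerA| + |Σ_{x′}w·kerB|` (`kerC = −kerA + kerB`). [cite: Balaban1983Higgs3, (3.26) p.440] -/
theorem abs_sum_kerC_le (w η τ : ℝ) (X Y : Kernel P j) (μ μ' : Fin P.d) (x : Site P j) :
    |∑ x' : Site P j, w * kerC η τ X Y μ μ' x x'| ≤
      |∑ x' : Site P j, w * (τ * (dAdjKernel η⁻¹ μ' X x x' * dAdjKernel η⁻¹ μ Y x' x))| +
        |∑ x' : Site P j, w * (τ * (X x x' * d2Kernel η⁻¹ μ' μ Y x' x))| := by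
  have h : ∑ x' : Site P j, w * kerC η τ X Y μ μ' x x' =
      -(∑ x' : Site P j, w * (τ * (dAdjKernel η⁻¹ μ' X x x' * dAdjKernel η⁻¹ μ Y x' x))) +
        ∑ x' : Site P j, w * (τ * (X x x' * d2Kernel η⁻¹ μ' μ Y x' x)) := by
    rw [← Finset.sum_neg_distrib, ← Finset.sum_add_distrib]
    simp only [kerC, kerA, kerB]
    exact Finset.sum_congr rfl fun x' _ => by ring
  rw [h]
  refine (abs_add_le _ _).trans (add_le_add ?_ le_rfl)
  rw [abs_neg]

/-- kernel: pulling `tr q² = τ` out of a (3.26) graph, `Σ_{x′}w·τ(a(x′)κ(x′)) = τ·Σ_{x′}w(a(x′)κ(x′))`. [cite: Balaban1983Higgs3, (3.26) p.440] -/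
theorem sum_mul_pull (w τ : ℝ) (a κ : Site P j → ℝ) :
    ∑ x' : Site P j, w * (τ * (a x' * κ x')) = τ * ∑ x' : Site P j, w * (a x' * κ x') := by
  rw [Finset.mul_sum]
  exact Finset.sum_congr rfl fun x' _ => by ring

end Generic

/-! ## §4 `Π_{μμ′}[C + M] − Π_{μμ′}[C]` -/

section Pi2

/-- kernel: bilinearity of the combined (3.26) kernel, `kerC[C+M, C+M] = kerC[C,C] + kerC[M,M] + kerC[M,C] + kerC[C,M]`.
[cite: Balaban1983Higgs3, (3.26) p.440] -/
theorem kerC_add_add (η τ : ℝ) (C M : Kernel P j) (μ μ' : Fin P.d) (x x' : Site P j) :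
    kerC η τ (C + M) (C + M) μ μ' x x' =
      kerC η τ C C μ μ' x x' + kerC η τ M M μ μ' x x' + kerC η τ M C μ μ' x x' + kerC η τ C M μ μ' x x' := by
  simp only [kerC, kerA, kerB, dAdjKernel, d2Kernel, Pi.add_apply]; ring

/-- **`Π_{μμ′}[C+M, C+M, C+M](x) − Π_{μμ′}[C,C,C](x) = Σ_{x′}ξ^d(kerC[M,M] + kerC[M,C] + kerC[C,M])(x,x′) − δ_{μμ′}τM(x,x) −
δ_{μμ′}τξ(M∂^*_μ)(x,x)`** — the difference of r15's `Pi2` at `G = C + M` and at `C` consists exactly of the graphs with AT LEAST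
ONE propagator `M` (p. 441: *"If at least one propagator … is replaced by [M] …"*). [cite: Balaban1983Higgs3, (3.26) pp.440–441] -/
theorem Pi2_add_sub (η τ : ℝ) (C M : Kernel P j) (μ μ' : Fin P.d) (x : Site P j) :
    Pi2 η τ (C + M) (C + M) (C + M) μ μ' x - Pi2 η τ C C C μ μ' x =
      (∑ x' : Site P j, η ^ P.d * kerC η τ M M μ μ' x x') + (∑ x' : Site P j, η ^ P.d * kerC η τ M C μ μ' x x') +
          (∑ x' : Site P j, η ^ P.d * kerC η τ C M μ μ' x x') -
        (if μ = μ' then τ * M x x else 0) - (if μ = μ' then τ * (η * dAdjKernel η⁻¹ μ M x x) else 0) := by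
  have hA : dAdjKernel η⁻¹ μ (C + M) x x = dAdjKernel η⁻¹ μ C x x + dAdjKernel η⁻¹ μ M x x := by
    simp only [dAdjKernel, Pi.add_apply]; ring
  simp only [Pi2, kerC_add_add, mul_add, Finset.sum_add_distrib, hA, Pi.add_apply]
  split_ifs <;> ring

end Pi2

end

end Literature.MathematicalPhysics.QuantumFieldTheory.Balaban1983to89.B3Eq326GraphKernelParts
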